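import Summits.HodgeConjecture.CorCM.IrreducibleOddWeightsIsotypicInvariance
import HarnessLib

/-!
# Isotypic cells, existence VIII: THE ISOTYPIC COMPONENTS OF A SLOT ARE INTRINSIC AND THE MULTIPLICITIES ARE
# CANONICAL — every irreducible constituent into which `A_c` embeds lies in `P_c = ⨆_j ι_{c,j}(A_c)`,
# `dim P_c = m_c·dim A_c`, and two decompositions with `A_c ≅ A′_{c′}` have `m_c = m′_{c′}`

COR-CM (cell `pub-hodgecm2`, binder seat `b16` gen 76, count-neutral claim THE ISOTYPIC DECOMPOSITION EXISTS, file
E8 — abstract `G`-set level; theorems only, no definition, no named fact, no `sorry`).  NEW as organised here, hence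
under `Summits/`.  HONEST FRAMING: the uniqueness half of the isotypic (canonical) decomposition of the permutation
module `ℚ^{Y₀}` of a finite `G`-set, in the unbundled currency of the master theorem E3: for data (references `A_c`
stable irreducible non-zero pairwise non-embeddable, embeddings `ι_{c,j} : ℚ^{Y_c} → ℚ^{Y₀}` equivariant and jointly
independent on `A_c`, images spanning) the class-`c` ISOTYPIC COMPONENT `P_c = ⨆_j ι_{c,j}(A_c)` contains every
stable irreducible `N ≤ ℚ^{Y₀}` into which `A_c` embeds, so it does not depend on the data, and
`dim P_c = |J_c|·dim A_c` makes the multiplicity `m_c = |J_c|` canonical (E7 did the same for the multiplicities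
`r_c` of the Hodge character module).  Nothing about Hodge classes is asserted; `HC_CM` is neither used nor asserted.

* §1 `injOn_of_irreducible_of_map_ne_bot` (an equivariant map is injective on a stable irreducible `N` unless it
  kills `N`), `iSupIndep_map_of_jointly_independent` (joint independence ⟹ the images `ι_j(A)` are independent),
  `finrank_iSup_map_eq_card_mul` (**`dim ⨆_j ι_j(A) = |J|·dim A`**).
* §2 **EVERY CONSTITUENT OF CLASS `c` LIES IN `P_c`** (`le_iSup_map_of_embed`): `N ≤ ℚ^{Y₀}` stable irreducible
  with an equivariant embedding `θ : A_c ↪ N` ⟹ `N ≤ P_c` (project onto `P_c` along `Q = ⨆_{c′ ≠ c} P_{c′}`, gen 70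
  I1 + gen 75 M1; `(1 − π)(N) ≤ Q` is zero, else an irreducible onto which `A_c` and some `A_{c′}`, `c′ ≠ c`, both
  map (Jordan–Hölder-lite, I2) — excluded by E6 `eq_of_embed_of_onto`).
* §3 **THE ISOTYPIC COMPONENT IS INTRINSIC** (`iSup_map_eq_iSup_irreducible`): `P_c` is the `⨆` of ALL stable
  irreducible `N ≤ ℚ^{Y₀}` receiving an equivariant embedding of `A_c`.
* §4 **THE MULTIPLICITIES ARE CANONICAL** (`iSup_map_eq_iSup_map_of_embed`, `card_eq_card_of_embed`): for two such
  data on the same slot and classes `c`, `c′` with an equivariant embedding `A_c ↪ A′_{c′}`: `P_c = P′_{c′}`,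
  `dim A_c = dim A′_{c′}` and **`|J_c| = |J′_{c′}|`**.

## References

* [Serre1977] J.-P. Serre, *Linear Representations of Finite Groups*, GTM 42, §2.6 Thm. 8 (the canonical
  decomposition does not depend on the chosen decomposition into irreducibles), §2.7.
* [Lang2002] S. Lang, *Algebra*, 3rd ed., XVII §1 Prop. 1.1, XVII §2 (uniqueness of multiplicities).
* [CurtisReiner1962] C. W. Curtis, I. Reiner, *Representation Theory of Finite Groups and Associative Algebras*,
  §14 (Krull–Schmidt), §15.
-/

set_option autoImplicit false

noncomputable section

open scoped BigOperators Classical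

universe uC uC' uJ uJ' uW v' vA vC vC' w

namespace Summit.HodgeConjecture.CorCM.IrrOdd

open Literature.NumberTheory.ComplexMultiplication

variable {G : Type w} [Group G] {Y₀ : Type v'} [MulAction G Y₀]

/-! ### §1 Injectivity on irreducibles; independence and dimension of the images -/

section Basic

variable {YA : Type vA} [MulAction G YA]

/-- **AN EQUIVARIANT MAP IS INJECTIVE ON A STABLE IRREDUCIBLE `N` UNLESS IT KILLS `N`**: if `ψ(N) ≠ 0` then `ψ`
is injective on `N` (otherwise `N ⊓ ker ψ` is a non-zero stable subspace, hence all of `N`). [cite: Serre1977,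
§2.2] -/
theorem injOn_of_irreducible_of_map_ne_bot {W : Type uW} [AddCommGroup W] [Module ℚ W] {N : Submodule ℚ (Y₀ → ℚ)}
    (ψ : (Y₀ → ℚ) →ₗ[ℚ] W) (TW : G → W →ₗ[ℚ] W)
    (hNst : ∀ (k : G) (f : Y₀ → ℚ), f ∈ N → (fun y => f (k • y)) ∈ N)
    (hNirr : ∀ W' : Submodule ℚ (Y₀ → ℚ), W' ≤ N → W' ≠ ⊥ →
      (∀ (k : G) (f : Y₀ → ℚ), f ∈ W' → (fun y => f (k • y)) ∈ W') → W' = N)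
    (hψeq : ∀ (k : G) (n : Y₀ → ℚ), n ∈ N → ψ (fun y => n (k • y)) = TW k (ψ n))
    (hne : N.map ψ ≠ ⊥) : ∀ n ∈ N, ψ n = 0 → n = 0 := by
  by_contra hcon
  push Not at hcon
  obtain ⟨n₀, hn₀, hψn₀, hn₀0⟩ := hcon
  have hker : N ⊓ LinearMap.ker ψ = N := by
    refine hNirr _ inf_le_left ?_ fun k f hf => Submodule.mem_inf.2 ⟨hNst k f (Submodule.mem_inf.1 hf).1, ?_⟩
    · intro h
      have hmem : n₀ ∈ N ⊓ LinearMap.ker ψ := Submodule.mem_inf.2 ⟨hn₀, LinearMap.mem_ker.2 hψn₀⟩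
      rw [h, Submodule.mem_bot] at hmem
      exact hn₀0 hmem
    · rw [LinearMap.mem_ker, hψeq k f (Submodule.mem_inf.1 hf).1,
        LinearMap.mem_ker.1 (Submodule.mem_inf.1 hf).2, map_zero]
  apply hne
  rw [eq_bot_iff]
  intro w hw
  obtain ⟨n, hn, rfl⟩ := Submodule.mem_map.1 hw
  have hn' : n ∈ N ⊓ LinearMap.ker ψ := by rw [hker]; exact hn
  rw [Submodule.mem_bot]
  exact LinearMap.mem_ker.1 (Submodule.mem_inf.1 hn').2

omit [Group G] [MulAction G Y₀] [MulAction G YA] in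
/-- **JOINT INDEPENDENCE MAKES THE IMAGES INDEPENDENT**: if `Σ_j ι_j(f_j) = 0` with all `f_j ∈ A` forces all
`f_j = 0`, then the subspaces `ι_j(A)` (`j ∈ J`) form an independent family. [cite: Lang2002, XVII §1] -/
theorem iSupIndep_map_of_jointly_independent {J : Type uJ} [Fintype J] {A : Submodule ℚ (YA → ℚ)}
    (ι : J → ((YA → ℚ) →ₗ[ℚ] (Y₀ → ℚ)))
    (hind : ∀ f : J → (YA → ℚ), (∀ j, f j ∈ A) → ∑ j, ι j (f j) = 0 → ∀ j, f j = 0) :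
    iSupIndep fun j => A.map (ι j) := by
  refine (iSupIndep_iff_finsetSum_eq_zero_imp_eq_zero _).2 fun s v hv h0 j hj => ?_
  -- choose preimages on `s`, zero elsewhere
  have hex : ∀ j', ∃ a : YA → ℚ, a ∈ A ∧ (j' ∈ s → ι j' a = v j') := by
    intro j'
    by_cases hj' : j' ∈ s
    · obtain ⟨a, ha, hav⟩ := Submodule.mem_map.1 (hv j' hj')
      exact ⟨a, ha, fun _ => hav⟩
    · exact ⟨0, A.zero_mem, fun h => absurd h hj'⟩
  choose a ha hav using hex
  have hmem : ∀ j', (if j' ∈ s then a j' else 0) ∈ A := fun j' => by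
    by_cases h : j' ∈ s
    · rw [if_pos h]; exact ha j'
    · rw [if_neg h]; exact A.zero_mem
  have hsum : ∑ j', ι j' (if j' ∈ s then a j' else 0) = 0 := by
    rw [← Finset.sum_subset (Finset.subset_univ s) (fun j' _ hj' => by rw [if_neg hj', map_zero]), ← h0]
    exact Finset.sum_congr rfl fun j' hj' => by rw [if_pos hj', hav j' hj']
  have h := hind (fun j' => if j' ∈ s then a j' else 0) hmem hsum j
  rw [if_pos hj] at h
  rw [← hav j hj, h, map_zero]

omit [Group G] [MulAction G Y₀] [MulAction G YA] in
/-- **`dim ⨆_j ι_j(A) = |J|·dim A`** for maps `ι_j` injective on `A` with independent images. [cite: Serre1977, §2.6] -/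
theorem finrank_iSup_map_eq_card_mul [Fintype Y₀] {J : Type uJ} [Fintype J] {A : Submodule ℚ (YA → ℚ)}
    (ι : J → ((YA → ℚ) →ₗ[ℚ] (Y₀ → ℚ))) (hinj : ∀ (j : J) (a : YA → ℚ), a ∈ A → ι j a = 0 → a = 0)
    (hind : iSupIndep fun j => A.map (ι j)) :
    Module.finrank ℚ ↥(⨆ j, A.map (ι j)) = Fintype.card J * Module.finrank ℚ A := by
  rw [(finrank_iSup_eq_sum_finrank_iff_iSupIndep fun j => A.map (ι j)).2 hind,
    Finset.sum_congr rfl fun j _ => finrank_map_eq_of_injOn (ι j) A (hinj j), Finset.sum_const, Finset.card_univ,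
    smul_eq_mul]

end Basic

/-! ### §2 Every constituent of class `c` lies in the isotypic component `P_c` -/

section Component

variable [Fintype Y₀] {C : Type uC} [Fintype C] {Yc : C → Type vC} [∀ c, MulAction G (Yc c)]
  [∀ c, Fintype (Yc c)] {Ar : ∀ c, Submodule ℚ (Yc c → ℚ)} {JJ : C → Type uJ} [∀ c, Fintype (JJ c)]

/-- **EVERY STABLE IRREDUCIBLE INTO WHICH `A_c` EMBEDS LIES IN `P_c = ⨆_j ι_{c,j}(A_c)`.**  Data: references `A_c`
stable irreducible non-zero pairwise non-embeddable, embeddings `ι_{c,j}` equivariant and jointly independent on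
`A_c`, images spanning `ℚ^{Y₀}`.  If `N ≤ ℚ^{Y₀}` is stable irreducible and `θ : ℚ^{Y_c} → ℚ^{Y₀}` maps `A_c` into `N`
injectively and equivariantly, then `N ≤ P_c` (projection onto `P_c` along the other classes; see the module
docstring). [cite: Serre1977, §2.6 Thm. 8] [cite: Lang2002, XVII §2] -/
theorem le_iSup_map_of_embed
    (hRst : ∀ c (k : G) (a : Yc c → ℚ), a ∈ Ar c → (fun y => a (k • y)) ∈ Ar c)
    (hRirr : ∀ c (W : Submodule ℚ (Yc c → ℚ)), W ≤ Ar c → W ≠ ⊥ →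
      (∀ (k : G) (f : Yc c → ℚ), f ∈ W → (fun y => f (k • y)) ∈ W) → W = Ar c)
    (hR0 : ∀ c, Ar c ≠ ⊥)
    (hsep : ∀ c c' (L : (Yc c → ℚ) →ₗ[ℚ] (Yc c' → ℚ)), c ≠ c' → Ar c ≠ ⊥ → (∀ a ∈ Ar c, L a ∈ Ar c') →
      (∀ a ∈ Ar c, L a = 0 → a = 0) →
      (∀ (k : G) (a : Yc c → ℚ), a ∈ Ar c → L (fun y => a (k • y)) = fun y => L a (k • y)) → False)
    (ι : ∀ c, JJ c → ((Yc c → ℚ) →ₗ[ℚ] (Y₀ → ℚ)))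
    (hιeq : ∀ c (j : JJ c) (k : G) (a : Yc c → ℚ), a ∈ Ar c →
      ι c j (fun y => a (k • y)) = fun y => ι c j a (k • y))
    (hind : ∀ c (f : JJ c → (Yc c → ℚ)), (∀ j, f j ∈ Ar c) → ∑ j, ι c j (f j) = 0 → ∀ j, f j = 0)
    (htop : (⨆ c, ⨆ j, (Ar c).map (ι c j)) = ⊤)
    {N : Submodule ℚ (Y₀ → ℚ)} (hNst : ∀ (k : G) (f : Y₀ → ℚ), f ∈ N → (fun y => f (k • y)) ∈ N)
    (hNirr : ∀ W : Submodule ℚ (Y₀ → ℚ), W ≤ N → W ≠ ⊥ →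
      (∀ (k : G) (f : Y₀ → ℚ), f ∈ W → (fun y => f (k • y)) ∈ W) → W = N)
    {c : C} (θ : (Yc c → ℚ) →ₗ[ℚ] (Y₀ → ℚ)) (hθN : ∀ a ∈ Ar c, θ a ∈ N)
    (hθinj : ∀ a ∈ Ar c, θ a = 0 → a = 0)
    (hθeq : ∀ (k : G) (a : Yc c → ℚ), a ∈ Ar c → θ (fun y => a (k • y)) = fun y => θ a (k • y)) :
    N ≤ ⨆ j, (Ar c).map (ι c j) := by
  let T : G → (Y₀ → ℚ) →ₗ[ℚ] (Y₀ → ℚ) := fun k => LinearMap.funLeft ℚ ℚ fun y : Y₀ => k • y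
  have himg := fun c' (j : JJ c') =>
    map_stable_irreducible_of_equivariant (G := G) (ι c' j) (hRst c') (hRirr c') (hιeq c' j)
  -- `P = P_c` and `Q = ⨆_{c' ≠ c} P_{c'}` (as a `⨆` over a finite index type)
  set P : Submodule ℚ (Y₀ → ℚ) := ⨆ j, (Ar c).map (ι c j) with hP
  set Q : Submodule ℚ (Y₀ → ℚ) :=
    ⨆ q : {q : Σ c', JJ c' // q.1 ≠ c}, (Ar q.1.1).map (ι q.1.1 q.1.2) with hQ
  have hPst : ∀ (k : G) (v : Y₀ → ℚ), v ∈ P → T k v ∈ P :=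
    stable_iSup T _ fun j k v hv => (himg c j).1 k v hv
  have hQst : ∀ (k : G) (v : Y₀ → ℚ), v ∈ Q → T k v ∈ Q :=
    stable_iSup T _ fun q k v hv => (himg q.1.1 q.1.2).1 k v hv
  have hQeq : (⨆ (c' : C) (_ : c' ≠ c), ⨆ j, (Ar c').map (ι c' j)) = Q := by
    refine le_antisymm (iSup₂_le fun c' hc' => iSup_le fun j => ?_) (iSup_le fun q => ?_)
    · exact le_iSup (fun q : {q : Σ c', JJ c' // q.1 ≠ c} => (Ar q.1.1).map (ι q.1.1 q.1.2)) ⟨⟨c', j⟩, hc'⟩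
    · exact (le_iSup (fun j => (Ar q.1.1).map (ι q.1.1 j)) q.1.2).trans
        (le_iSup₂ (f := fun c' (_ : c' ≠ c) => ⨆ j, (Ar c').map (ι c' j)) q.1.1 q.2)
  have hPQ : P ⊓ Q = ⊥ := by
    have h := iSupIndep_iSup_map_of_classes hRst hRirr hsep ι hιeq hind c
    rw [hQeq] at h
    exact disjoint_iff.1 h
  have hPQtop : P ⊔ Q = ⊤ := by
    rw [← hQeq, hP, ← iSup_split_single (fun c' => ⨆ j, (Ar c').map (ι c' j)) c, htop]
  obtain ⟨π, hπP, -, -, hπker, hπeq⟩ := exists_proj_of_inf_eq_bot T hPst hQst hPQ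
  have hmem : ∀ v : Y₀ → ℚ, v ∈ P ⊔ Q := fun v => by rw [hPQtop]; exact Submodule.mem_top
  -- `ψ = 1 − π`, equivariant everywhere, with `ψ(N) ≤ Q`
  set ψ : (Y₀ → ℚ) →ₗ[ℚ] (Y₀ → ℚ) := LinearMap.id - π with hψ
  have hψapply : ∀ v, ψ v = v - π v := fun v => rfl
  have hψeq : ∀ (k : G) (n : Y₀ → ℚ), n ∈ N → ψ (fun y => n (k • y)) = fun y => ψ n (k • y) := by
    intro k n _
    have h1 : π (fun y => n (k • y)) = fun y => π n (k • y) := hπeq k n (hmem n)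
    funext y
    simp only [hψapply, Pi.sub_apply, h1]
  by_cases hW : N.map ψ = ⊥
  · -- `ψ` kills `N`: `n = π n ∈ P`
    intro n hn
    have h0 : ψ n = 0 := by
      have h1 : ψ n ∈ N.map ψ := Submodule.mem_map_of_mem hn
      rwa [hW, Submodule.mem_bot] at h1
    rw [hψapply, sub_eq_zero] at h0
    rw [h0]
    exact hπP n
  · exfalso
    have hWsi := map_stable_irreducible_of_equivariant (G := G) ψ hNst hNirr hψeq
    have hWle : N.map ψ ≤ Q := Submodule.map_le_iff_le_comap.2 fun n _ => hπker n (hmem n)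
    have hψinj : ∀ n ∈ N, ψ n = 0 → n = 0 :=
      injOn_of_irreducible_of_map_ne_bot ψ T hNst hNirr (fun k n hn => hψeq k n hn) hW
    -- Jordan–Hölder-lite in `Q`: `ψ(N)` is the isomorphic image of some `ι_{c',j'}(A_{c'})`, `c' ≠ c`
    obtain ⟨q₀, -, Pq, -, hPqinj, hPqsurj, hPqeq⟩ := exists_iso_of_irreducible_le_iSup T
      (N := fun q : {q : Σ c', JJ c' // q.1 ≠ c} => (Ar q.1.1).map (ι q.1.1 q.1.2))
      (fun q k v hv => (himg q.1.1 q.1.2).1 k v hv)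
      (fun q W' hW' hW'0 hW'st => (himg q.1.1 q.1.2).2 W' hW' hW'0 fun k f hf => hW'st k f hf)
      (M := N.map ψ) (fun k v hv => hWsi.1 k v hv)
      (fun W' h1 h2 h3 => hWsi.2 W' h1 h2 fun k f hf => h3 k f hf) hW hWle
    -- both `A_{c'}` (onto) and `A_c` (into) map equivariantly and injectively to `ψ(N)`
    have key : q₀.1.1 = c := by
      refine eq_of_embed_of_onto (G := G) hRst hR0 hsep (N := N.map ψ) (Pq ∘ₗ ι q₀.1.1 q₀.1.2)
        (fun a ha h0 => ?_) (fun w hw => ?_) (fun k a ha => ?_) (ψ ∘ₗ θ)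
        (fun a ha => Submodule.mem_map_of_mem (hθN a ha)) (fun a ha h0 => ?_) (fun k a ha => ?_)
      · exact injOn_of_jointly_independent (ι q₀.1.1) (hind q₀.1.1) q₀.1.2 a ha
          (hPqinj _ (Submodule.mem_map_of_mem ha) h0)
      · obtain ⟨v, hv, hPv⟩ := hPqsurj w hw
        obtain ⟨a, ha, rfl⟩ := Submodule.mem_map.1 hv
        exact ⟨a, ha, hPv⟩
      · show Pq (ι q₀.1.1 q₀.1.2 (fun y => a (k • y))) = fun y => Pq (ι q₀.1.1 q₀.1.2 a) (k • y)
        rw [hιeq q₀.1.1 q₀.1.2 k a ha]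
        exact hPqeq k _ (Submodule.mem_map_of_mem ha)
      · exact hθinj a ha (hψinj _ (hθN a ha) h0)
      · show ψ (θ (fun y => a (k • y))) = fun y => ψ (θ a) (k • y)
        rw [hθeq k a ha]
        exact hψeq k _ (hθN a ha)
    exact q₀.2 key

/-! ### §3 The isotypic component is intrinsic -/

/-- **THE ISOTYPIC COMPONENT IS INTRINSIC**: `P_c = ⨆_j ι_{c,j}(A_c)` is the `⨆` of ALL stable irreducible
`N ≤ ℚ^{Y₀}` into which `A_c` embeds equivariantly — a description that does not mention the chosen data.
[cite: Serre1977, §2.6 Thm. 8] -/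
theorem iSup_map_eq_iSup_irreducible
    (hRst : ∀ c (k : G) (a : Yc c → ℚ), a ∈ Ar c → (fun y => a (k • y)) ∈ Ar c)
    (hRirr : ∀ c (W : Submodule ℚ (Yc c → ℚ)), W ≤ Ar c → W ≠ ⊥ →
      (∀ (k : G) (f : Yc c → ℚ), f ∈ W → (fun y => f (k • y)) ∈ W) → W = Ar c)
    (hR0 : ∀ c, Ar c ≠ ⊥)
    (hsep : ∀ c c' (L : (Yc c → ℚ) →ₗ[ℚ] (Yc c' → ℚ)), c ≠ c' → Ar c ≠ ⊥ → (∀ a ∈ Ar c, L a ∈ Ar c') →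
      (∀ a ∈ Ar c, L a = 0 → a = 0) →
      (∀ (k : G) (a : Yc c → ℚ), a ∈ Ar c → L (fun y => a (k • y)) = fun y => L a (k • y)) → False)
    (ι : ∀ c, JJ c → ((Yc c → ℚ) →ₗ[ℚ] (Y₀ → ℚ)))
    (hιeq : ∀ c (j : JJ c) (k : G) (a : Yc c → ℚ), a ∈ Ar c →
      ι c j (fun y => a (k • y)) = fun y => ι c j a (k • y))
    (hind : ∀ c (f : JJ c → (Yc c → ℚ)), (∀ j, f j ∈ Ar c) → ∑ j, ι c j (f j) = 0 → ∀ j, f j = 0)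
    (htop : (⨆ c, ⨆ j, (Ar c).map (ι c j)) = ⊤) (c : C) :
    (⨆ j, (Ar c).map (ι c j)) =
      ⨆ (N : Submodule ℚ (Y₀ → ℚ)) (_ : (∀ (k : G) (f : Y₀ → ℚ), f ∈ N → (fun y => f (k • y)) ∈ N) ∧
        (∀ W : Submodule ℚ (Y₀ → ℚ), W ≤ N → W ≠ ⊥ →
          (∀ (k : G) (f : Y₀ → ℚ), f ∈ W → (fun y => f (k • y)) ∈ W) → W = N) ∧
        ∃ θ : (Yc c → ℚ) →ₗ[ℚ] (Y₀ → ℚ), (∀ a ∈ Ar c, θ a ∈ N) ∧ (∀ a ∈ Ar c, θ a = 0 → a = 0) ∧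
          ∀ (k : G) (a : Yc c → ℚ), a ∈ Ar c → θ (fun y => a (k • y)) = fun y => θ a (k • y)), N := by
  refine le_antisymm (iSup_le fun j => ?_) (iSup₂_le fun N hN => ?_)
  · have h := map_stable_irreducible_of_equivariant (G := G) (ι c j) (hRst c) (hRirr c) (hιeq c j)
    exact le_iSup₂ (f := fun (N : Submodule ℚ (Y₀ → ℚ)) (_ : (∀ (k : G) (f : Y₀ → ℚ), f ∈ N →
        (fun y => f (k • y)) ∈ N) ∧ (∀ W : Submodule ℚ (Y₀ → ℚ), W ≤ N → W ≠ ⊥ →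
          (∀ (k : G) (f : Y₀ → ℚ), f ∈ W → (fun y => f (k • y)) ∈ W) → W = N) ∧
        ∃ θ : (Yc c → ℚ) →ₗ[ℚ] (Y₀ → ℚ), (∀ a ∈ Ar c, θ a ∈ N) ∧ (∀ a ∈ Ar c, θ a = 0 → a = 0) ∧
          ∀ (k : G) (a : Yc c → ℚ), a ∈ Ar c → θ (fun y => a (k • y)) = fun y => θ a (k • y)) => N)
      ((Ar c).map (ι c j)) ⟨h.1, h.2, ι c j, fun a ha => Submodule.mem_map_of_mem ha,
        injOn_of_jointly_independent (ι c) (hind c) j, hιeq c j⟩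
  · obtain ⟨hNst, hNirr, θ, hθN, hθinj, hθeq⟩ := hN
    exact le_iSup_map_of_embed hRst hRirr hR0 hsep ι hιeq hind htop hNst hNirr θ hθN hθinj hθeq

/-! ### §4 The multiplicities are canonical -/

variable {C' : Type uC'} [Fintype C'] {Yc' : C' → Type vC'} [∀ c, MulAction G (Yc' c)] [∀ c, Fintype (Yc' c)]
  {Ar' : ∀ c, Submodule ℚ (Yc' c → ℚ)} {JJ' : C' → Type uJ'} [∀ c, Fintype (JJ' c)]

/-- **TWO DECOMPOSITIONS, ISOMORPHIC CLASSES: THE ISOTYPIC COMPONENTS COINCIDE.**  For two data on the same slot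
`ℚ^{Y₀}` and classes `c`, `c′` with an equivariant embedding `θ : A_c ↪ A′_{c′}`: **`P_c = P′_{c′}`** (every
`ι′_{c′,j′}(A′_{c′})` receives `ι′ ∘ θ : A_c`; every `ι_{c,j}(A_c)` receives `ι ∘ θ⁻¹`, the inverse existing by
irreducibility; §2 both ways). [cite: Serre1977, §2.6 Thm. 8] [cite: CurtisReiner1962, §14] -/
theorem iSup_map_eq_iSup_map_of_embed
    (hRst : ∀ c (k : G) (a : Yc c → ℚ), a ∈ Ar c → (fun y => a (k • y)) ∈ Ar c)
    (hRirr : ∀ c (W : Submodule ℚ (Yc c → ℚ)), W ≤ Ar c → W ≠ ⊥ →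
      (∀ (k : G) (f : Yc c → ℚ), f ∈ W → (fun y => f (k • y)) ∈ W) → W = Ar c)
    (hR0 : ∀ c, Ar c ≠ ⊥)
    (hsep : ∀ c c' (L : (Yc c → ℚ) →ₗ[ℚ] (Yc c' → ℚ)), c ≠ c' → Ar c ≠ ⊥ → (∀ a ∈ Ar c, L a ∈ Ar c') →
      (∀ a ∈ Ar c, L a = 0 → a = 0) →
      (∀ (k : G) (a : Yc c → ℚ), a ∈ Ar c → L (fun y => a (k • y)) = fun y => L a (k • y)) → False)
    (ι : ∀ c, JJ c → ((Yc c → ℚ) →ₗ[ℚ] (Y₀ → ℚ)))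
    (hιeq : ∀ c (j : JJ c) (k : G) (a : Yc c → ℚ), a ∈ Ar c →
      ι c j (fun y => a (k • y)) = fun y => ι c j a (k • y))
    (hind : ∀ c (f : JJ c → (Yc c → ℚ)), (∀ j, f j ∈ Ar c) → ∑ j, ι c j (f j) = 0 → ∀ j, f j = 0)
    (htop : (⨆ c, ⨆ j, (Ar c).map (ι c j)) = ⊤)
    (hRst' : ∀ c (k : G) (a : Yc' c → ℚ), a ∈ Ar' c → (fun y => a (k • y)) ∈ Ar' c)
    (hRirr' : ∀ c (W : Submodule ℚ (Yc' c → ℚ)), W ≤ Ar' c → W ≠ ⊥ →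
      (∀ (k : G) (f : Yc' c → ℚ), f ∈ W → (fun y => f (k • y)) ∈ W) → W = Ar' c)
    (hR0' : ∀ c, Ar' c ≠ ⊥)
    (hsep' : ∀ c c' (L : (Yc' c → ℚ) →ₗ[ℚ] (Yc' c' → ℚ)), c ≠ c' → Ar' c ≠ ⊥ → (∀ a ∈ Ar' c, L a ∈ Ar' c') →
      (∀ a ∈ Ar' c, L a = 0 → a = 0) →
      (∀ (k : G) (a : Yc' c → ℚ), a ∈ Ar' c → L (fun y => a (k • y)) = fun y => L a (k • y)) → False)
    (ι' : ∀ c, JJ' c → ((Yc' c → ℚ) →ₗ[ℚ] (Y₀ → ℚ)))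
    (hιeq' : ∀ c (j : JJ' c) (k : G) (a : Yc' c → ℚ), a ∈ Ar' c →
      ι' c j (fun y => a (k • y)) = fun y => ι' c j a (k • y))
    (hind' : ∀ c (f : JJ' c → (Yc' c → ℚ)), (∀ j, f j ∈ Ar' c) → ∑ j, ι' c j (f j) = 0 → ∀ j, f j = 0)
    (htop' : (⨆ c, ⨆ j, (Ar' c).map (ι' c j)) = ⊤)
    {c : C} {c' : C'} (θ : (Yc c → ℚ) →ₗ[ℚ] (Yc' c' → ℚ)) (hθA : ∀ a ∈ Ar c, θ a ∈ Ar' c')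
    (hθinj : ∀ a ∈ Ar c, θ a = 0 → a = 0)
    (hθeq : ∀ (k : G) (a : Yc c → ℚ), a ∈ Ar c → θ (fun y => a (k • y)) = fun y => θ a (k • y)) :
    (⨆ j, (Ar c).map (ι c j)) = ⨆ j, (Ar' c').map (ι' c' j) := by
  -- `θ` is onto, and an inverse embedding `θ' : A'_{c'} ↪ A_c` exists
  have hsurj : ∀ b ∈ Ar' c', ∃ a ∈ Ar c, θ a = b :=
    onto_of_embed_of_irreducible' (G := G) θ (hRst c) (hR0 c) (hRirr' c') hθA hθinj hθeq
  have hL : ∀ v ∈ (Ar' c').map (LinearMap.id : (Yc' c' → ℚ) →ₗ[ℚ] (Yc' c' → ℚ)),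
      (LinearMap.id : (Yc' c' → ℚ) →ₗ[ℚ] (Yc' c' → ℚ)) v ∈ (Ar c).map θ := by
    intro v hv
    rw [Submodule.map_id] at hv
    obtain ⟨a, ha, hθa⟩ := hsurj v hv
    exact Submodule.mem_map.2 ⟨a, ha, hθa⟩
  obtain ⟨θ', hθ'A, hθ'inj, hθ'eq⟩ := exists_embed_of_map_embed (G := G) (hRst' c') (hRst c) LinearMap.id θ
    (fun _ _ _ => rfl) hθeq (fun _ _ h => h) hθinj LinearMap.id hL (fun v _ h => h) (fun _ _ _ => rfl)
  have himg := fun j => map_stable_irreducible_of_equivariant (G := G) (ι c j) (hRst c) (hRirr c) (hιeq c j)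
  have himg' := fun j => map_stable_irreducible_of_equivariant (G := G) (ι' c' j) (hRst' c') (hRirr' c') (hιeq' c' j)
  refine le_antisymm (iSup_le fun j => ?_) (iSup_le fun j => ?_)
  · -- `ι_{c,j}(A_c)` receives `ι_{c,j} ∘ θ' : A'_{c'}`
    refine le_iSup_map_of_embed hRst' hRirr' hR0' hsep' ι' hιeq' hind' htop' (himg j).1 (himg j).2
      (ι c j ∘ₗ θ') (fun a ha => Submodule.mem_map_of_mem (hθ'A a ha)) (fun a ha h0 => ?_) fun k a ha => ?_
    · exact hθ'inj a ha (injOn_of_jointly_independent (ι c) (hind c) j _ (hθ'A a ha) h0)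
    · show ι c j (θ' (fun y => a (k • y))) = fun y => ι c j (θ' a) (k • y)
      rw [hθ'eq k a ha]
      exact hιeq c j k _ (hθ'A a ha)
  · -- `ι'_{c',j}(A'_{c'})` receives `ι'_{c',j} ∘ θ : A_c`
    refine le_iSup_map_of_embed hRst hRirr hR0 hsep ι hιeq hind htop (himg' j).1 (himg' j).2
      (ι' c' j ∘ₗ θ) (fun a ha => Submodule.mem_map_of_mem (hθA a ha)) (fun a ha h0 => ?_) fun k a ha => ?_
    · exact hθinj a ha (injOn_of_jointly_independent (ι' c') (hind' c') j _ (hθA a ha) h0)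
    · show ι' c' j (θ (fun y => a (k • y))) = fun y => ι' c' j (θ a) (k • y)
      rw [hθeq k a ha]
      exact hιeq' c' j k _ (hθA a ha)

/-- **THE MULTIPLICITIES ARE CANONICAL: `|J_c| = |J′_{c′}|`** (and `dim A_c = dim A′_{c′}`) for two decompositions of
the same slot and classes `c`, `c′` with an equivariant embedding `A_c ↪ A′_{c′}` — `|J_c|·dim A_c = dim P_c =
dim P′_{c′} = |J′_{c′}|·dim A′_{c′}`. [cite: Serre1977, §2.6 Thm. 8] [cite: Lang2002, XVII §2]
[cite: CurtisReiner1962, §14] -/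
theorem card_eq_card_of_embed
    (hRst : ∀ c (k : G) (a : Yc c → ℚ), a ∈ Ar c → (fun y => a (k • y)) ∈ Ar c)
    (hRirr : ∀ c (W : Submodule ℚ (Yc c → ℚ)), W ≤ Ar c → W ≠ ⊥ →
      (∀ (k : G) (f : Yc c → ℚ), f ∈ W → (fun y => f (k • y)) ∈ W) → W = Ar c)
    (hR0 : ∀ c, Ar c ≠ ⊥)
    (hsep : ∀ c c' (L : (Yc c → ℚ) →ₗ[ℚ] (Yc c' → ℚ)), c ≠ c' → Ar c ≠ ⊥ → (∀ a ∈ Ar c, L a ∈ Ar c') →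
      (∀ a ∈ Ar c, L a = 0 → a = 0) →
      (∀ (k : G) (a : Yc c → ℚ), a ∈ Ar c → L (fun y => a (k • y)) = fun y => L a (k • y)) → False)
    (ι : ∀ c, JJ c → ((Yc c → ℚ) →ₗ[ℚ] (Y₀ → ℚ)))
    (hιeq : ∀ c (j : JJ c) (k : G) (a : Yc c → ℚ), a ∈ Ar c →
      ι c j (fun y => a (k • y)) = fun y => ι c j a (k • y))
    (hind : ∀ c (f : JJ c → (Yc c → ℚ)), (∀ j, f j ∈ Ar c) → ∑ j, ι c j (f j) = 0 → ∀ j, f j = 0)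
    (htop : (⨆ c, ⨆ j, (Ar c).map (ι c j)) = ⊤)
    (hRst' : ∀ c (k : G) (a : Yc' c → ℚ), a ∈ Ar' c → (fun y => a (k • y)) ∈ Ar' c)
    (hRirr' : ∀ c (W : Submodule ℚ (Yc' c → ℚ)), W ≤ Ar' c → W ≠ ⊥ →
      (∀ (k : G) (f : Yc' c → ℚ), f ∈ W → (fun y => f (k • y)) ∈ W) → W = Ar' c)
    (hR0' : ∀ c, Ar' c ≠ ⊥)
    (hsep' : ∀ c c' (L : (Yc' c → ℚ) →ₗ[ℚ] (Yc' c' → ℚ)), c ≠ c' → Ar' c ≠ ⊥ → (∀ a ∈ Ar' c, L a ∈ Ar' c') →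
      (∀ a ∈ Ar' c, L a = 0 → a = 0) →
      (∀ (k : G) (a : Yc' c → ℚ), a ∈ Ar' c → L (fun y => a (k • y)) = fun y => L a (k • y)) → False)
    (ι' : ∀ c, JJ' c → ((Yc' c → ℚ) →ₗ[ℚ] (Y₀ → ℚ)))
    (hιeq' : ∀ c (j : JJ' c) (k : G) (a : Yc' c → ℚ), a ∈ Ar' c →
      ι' c j (fun y => a (k • y)) = fun y => ι' c j a (k • y))
    (hind' : ∀ c (f : JJ' c → (Yc' c → ℚ)), (∀ j, f j ∈ Ar' c) → ∑ j, ι' c j (f j) = 0 → ∀ j, f j = 0)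
    (htop' : (⨆ c, ⨆ j, (Ar' c).map (ι' c j)) = ⊤)
    {c : C} {c' : C'} (θ : (Yc c → ℚ) →ₗ[ℚ] (Yc' c' → ℚ)) (hθA : ∀ a ∈ Ar c, θ a ∈ Ar' c')
    (hθinj : ∀ a ∈ Ar c, θ a = 0 → a = 0)
    (hθeq : ∀ (k : G) (a : Yc c → ℚ), a ∈ Ar c → θ (fun y => a (k • y)) = fun y => θ a (k • y)) :
    Module.finrank ℚ (Ar c) = Module.finrank ℚ (Ar' c') ∧ Fintype.card (JJ c) = Fintype.card (JJ' c') := by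
  -- `θ(A_c) = A'_{c'}`, so the dimensions agree
  have hsurj : ∀ b ∈ Ar' c', ∃ a ∈ Ar c, θ a = b :=
    onto_of_embed_of_irreducible' (G := G) θ (hRst c) (hR0 c) (hRirr' c') hθA hθinj hθeq
  have hmap : (Ar c).map θ = Ar' c' := by
    refine le_antisymm (Submodule.map_le_iff_le_comap.2 fun a ha => hθA a ha) fun b hb => ?_
    obtain ⟨a, ha, rfl⟩ := hsurj b hb
    exact Submodule.mem_map_of_mem ha
  have hdim : Module.finrank ℚ (Ar c) = Module.finrank ℚ (Ar' c') := by
    rw [← hmap, finrank_map_eq_of_injOn θ (Ar c) hθinj]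
  refine ⟨hdim, ?_⟩
  -- `|J_c|·dim A_c = dim P_c = dim P'_{c'} = |J'_{c'}|·dim A'_{c'}`
  have hP := iSup_map_eq_iSup_map_of_embed hRst hRirr hR0 hsep ι hιeq hind htop hRst' hRirr' hR0' hsep' ι' hιeq'
    hind' htop' θ hθA hθinj hθeq
  have h1 := finrank_iSup_map_eq_card_mul (ι c) (injOn_of_jointly_independent (ι c) (hind c))
    (iSupIndep_map_of_jointly_independent (ι c) (hind c))
  have h2 := finrank_iSup_map_eq_card_mul (ι' c') (injOn_of_jointly_independent (ι' c') (hind' c'))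
    (iSupIndep_map_of_jointly_independent (ι' c') (hind' c'))
  rw [hP, h2, hdim] at h1
  have hpos : 0 < Module.finrank ℚ (Ar' c') :=
    Module.finrank_pos_iff_exists_ne_zero.2 (by
      obtain ⟨a, ha, h0⟩ := Submodule.exists_mem_ne_zero_of_ne_bot (hR0' c')
      exact ⟨⟨a, ha⟩, fun h => h0 (congrArg Subtype.val h)⟩)
  exact (Nat.eq_of_mul_eq_mul_right hpos h1).symm

end Component

end Summit.HodgeConjecture.CorCM.IrrOdd

end
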